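import Literature.InformationTheory.QuantumCodes.QuantumReedMullerCodes
import Literature.InformationTheory.QuantumCodes.HypergraphProductGallagerFamily
import Literature.InformationTheory.QuantumCodes.HypergraphProductKernels
import Literature.InformationTheory.QuantumCodes.HypergraphProductSectorDistances
import Literature.InformationTheory.QuantumCodes.OptimalRadius
import Literature.InformationTheory.Coding.SubfieldImage
import Summits.Ventures.QEC.Basic.HypergraphProductCensus
import HarnessLib

/-!
# The hypergraph product of the Reed–Muller generator matrix with itself: a KERNEL-CERTIFIED two-parameter family
# `HGP(G_{b,m}, G_{b,m}) = [[4^m + A², (2^m − A)², 2^{b+1}]]`, `A = Σ_{i≤b} C(m,i)`, every `b < m`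

LADDER-QEC (venture cell `qec`), PARTITION row 08 (decoders / Q4 correction radius; qec-type-08 gen 6, «08.HGPRM», in the
lineage of `Decoders/HGPHammingFamily.lean` (HGP of the Hamming CHECK matrix) and item 141 «08.QRM» (the Reed–Muller
matrices)). The seed is the GENERATOR matrix `G_{b,m}` of `ℛ(b,m)` (`QRM.genMatrix m b`: rows = the monomials of degree `≤ b`,
full rank `A = Σ_{i≤b} C(m,i)`; as a parity-check matrix it defines `ker G_{b,m} = ℛ(b,m)^⊥ = ℛ(m−b−1,m) =
[2^m, 2^m − A, 2^{b+1}]` by MacWilliams–Sloane Ch. 13 Thms 3–4, KERNEL in `QuantumReedMullerCodes.lean`; `ker Gᵀ = 0`).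
Tillich–Zémor's Theorem 1 (through qec-type-04's census bridge `HGP.isCode_of_le_transpose`) then gives, for EVERY `b < m`,

  `HGP(G, G) = [[n² + A², (n − A)², d]] = [[4^m + A², (2^m − A)², 2^{b+1}]]`.

At the SELF-DUAL seeds (`m` odd, `b = (m−1)/2`, `A = 2^{m−1}`) this is a CONSTANT-RATE-`1/5` sub-family
`[[5·4^{m−1}, 4^{m−1}, 2^{(m+1)/2}]]` — `[[80,16,4]]`, `[[1280,256,8]]`, `[[20480,4096,16]]`, … — with `d = Θ(√N)`; other
members: `[[25,1,4]]` (`m = 2, b = 1`: the distance-4 planar patch), `[[113,1,8]]`, `[[281,121,4]]`, `[[377,25,8]]`.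

* `rmRows m b = Σ_{i≤b} C(m,i)`; `rmGen m b : Matrix (Fin (rmRows m b)) (Fin (2^m)) (ZMod 2)` — `QRM.genMatrix m b` re-indexed
  along `Fintype.equivFinOfCardEq` (TZ14's `HGP.code` wants `Fin`-indexed matrices) — (definitions);
* `rank_rmGen`, `pcCode_rmGen` (`= ℛ(m−b−1,m)` re-indexed), `minDist_pcCode_rmGen = 2^{b+1}`, `pcCode_rmGen_transpose = ⊥`;
* ★ `reedMuller_isCode (hb : b < m) : (HGP.code (rmGen m b) (rmGen m b)).IsCode (2^m·2^m + A·A) ((2^m − A)·(2^m − A)) (2^{b+1})`;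
* members `hgpRM_2_1 : [[25,1,4]]`, `hgpRM_3_1 : [[80,16,4]]`, `hgpRM_3_2 : [[113,1,8]]`, `hgpRM_4_1 : [[281,121,4]]`,
  `hgpRM_4_2 : [[377,25,8]]`, `hgpRM_5_2 : [[1280,256,8]]`, `hgpRM_7_3 : [[20480,4096,16]]`;
* Q4: `reedMuller_hasOptimalRadius` — radius `2^b − 1` attained (minimum-weight decoding) and optimal in both sectors.

TIER: CERTIFIED (KERNEL-std) — no `decide` beyond numeral arithmetic, no `native_decide`, 0 named facts, 0 sorry; axioms ⊆
{propext, Classical.choice, Quot.sound}. HONEST FRAMING: an INSTANCE of Tillich–Zémor Thm 1 with a textbook classical seed; the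
family is NOT LDPC (the rows of `G_{b,m}` have weight `2^{m−|S|} ≥ 2^{m−b}`); whether «HGP of Reed–Muller codes» is tabulated
in print is not asserted; code-capacity statements only; no novelty word.

References: [TillichZemor2014] Thm 1 (§6), Thm 7 / Thm 9 / Lemma 10 (arXiv v1 chunks p0007 L126-135, p0008 L11-15, L57-62);
[MacWilliamsSloane1977] Ch. 13 §3 Thms 3–4 (chunks p0306–p0309); [Gottesman1997] §2.3 (radius ⌊(d−1)/2⌋).
-/

namespace Summit.Ventures.QEC.HGP

open Matrix Finset Literature.InformationTheory.QuantumCodes Literature.InformationTheory.QuantumCodes.QRM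
open Literature.InformationTheory.Coding

/-- Re-reading an `[[n,k,d]]` statement with equal parameters. [folklore] -/
private theorem isCode_congr {RX RZ Q : Type*} [Fintype RX] [Fintype RZ] [Fintype Q] [DecidableEq Q]
    {C : CSSCode RX RZ Q} {n k d n' k' d' : ℕ} (h : C.IsCode n k d) (hn : n = n') (hk : k = k') (hd : d = d') :
    C.IsCode n' k' d' := by
  subst hn hk hd; exact h

/-! ## The flattened Reed–Muller generator matrix -/

/-- `A(m,b) = Σ_{i ≤ b} C(m,i)` — the number of monomials of degree `≤ b` in `m` variables (rows of `G_{b,m}`). (definition)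
[cite: MacWilliamsSloane1977, Ch. 13 §3 (chunk p0306: "k = 1 + C(m,1) + ⋯ + C(m,r)")] -/
def rmRows (m b : ℕ) : ℕ := ∑ i ∈ range (b + 1), m.choose i

/-- Row relabelling `Fin A(m,b) ≃ {S : |S| ≤ b}`. (definition) [cite: MacWilliamsSloane1977, Ch. 13 §3 (chunk p0306)] -/
noncomputable def rmRowEquiv (m b : ℕ) : Fin (rmRows m b) ≃ Mono m b :=
  (Fintype.equivFinOfCardEq (ReedMuller.card_monomials_le b m)).symm

/-- Column relabelling `Fin 2^m ≃ 𝔽₂^m` (the evaluation points). (definition) [cite: MacWilliamsSloane1977, Ch. 13 §1 (chunk p0306)] -/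
noncomputable def rmColEquiv (m : ℕ) : Fin (2 ^ m) ≃ (Fin m → ZMod 2) :=
  (Fintype.equivFinOfCardEq (by rw [Fintype.card_fun, ZMod.card, Fintype.card_fin])).symm

/-- **The Reed–Muller generator matrix `G_{b,m}` as a `Fin`-indexed matrix** (`QRM.genMatrix m b` re-indexed). (definition)
[cite: MacWilliamsSloane1977, Ch. 13 §3 (chunk p0306: the generator matrix of ℛ(r,m), rows = monomials of degree ≤ r)] -/
noncomputable def rmGen (m b : ℕ) : Matrix (Fin (rmRows m b)) (Fin (2 ^ m)) (ZMod 2) :=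
  (genMatrix m b).submatrix (rmRowEquiv m b) (rmColEquiv m)

/-- **`rank G_{b,m} = A(m,b)`** (the monomial functions are linearly independent). [cite: MacWilliamsSloane1977, Ch. 13 §3 (chunk p0306)] -/
theorem rank_rmGen (m b : ℕ) : (rmGen m b).rank = rmRows m b := by
  rw [rmGen, rank_submatrix, ← finrank_rowSpace_eq_rank, rowSpace_genMatrix, ReedMuller.finrank_code, rmRows]

/-- **`ker G_{b,m} = ℛ(m−b−1, m)`** (re-indexed along the column relabelling), `b + s + 1 = m`.
[cite: MacWilliamsSloane1977, Ch. 13 §3 Thm. 4 (chunks p0308–p0309: ℛ(m−r−1,m) = ℛ(r,m)^⊥)] -/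
theorem pcCode_rmGen {m b s : ℕ} (h : b + s + 1 = m) :
    pcCode (rmGen m b) = reindex (rmColEquiv m).symm (ReedMuller.code s m) := by
  have h1 : rmGen m b = ((genMatrix m b).submatrix (rmRowEquiv m b) id).submatrix id (rmColEquiv m) := rfl
  rw [h1]
  ext e
  rw [mem_pcCode_submatrix_iff, pcCode_submatrix_equiv_rows, pcCode_genMatrix h, mem_reindex_iff]
  rfl

/-- **`d(ker G_{b,m}) = 2^{b+1}`** for `b < m` (the minimum distance of `ℛ(m−b−1,m)`, MacWilliams–Sloane Ch. 13 Thm. 3).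
[cite: MacWilliamsSloane1977, Ch. 13 §3 Thm. 3 (chunk p0308: ℛ(r,m) has minimum distance 2^{m−r})] -/
theorem minDist_pcCode_rmGen {m b : ℕ} (hb : b < m) : minDist (pcCode (rmGen m b)) = (2 ^ (b + 1) : ℕ) := by
  obtain ⟨s, hs⟩ : ∃ s, b + s + 1 = m := ⟨m - b - 1, by omega⟩
  have hms : m - s = b + 1 := by omega
  rw [pcCode_rmGen hs, minDist_reindex]
  refine le_antisymm ?_ (le_minDist_iff.2 fun c hc h0 => ?_)
  · obtain ⟨v, hv, hw⟩ := ReedMullerMinDistance.exists_hammingNorm_eq (n := m) (r := s) (by omega)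
    rw [hms] at hw
    have h0 : v ≠ 0 := by
      intro h0; rw [h0, hammingNorm_zero] at hw; exact absurd hw.symm (pow_ne_zero _ two_ne_zero)
    have := minDist_le_hammingNorm (C := ReedMuller.code s m) hv h0
    rwa [hw] at this
  · have := ReedMullerMinDistance.two_pow_le_hammingNorm m s c hc h0
    rw [hms] at this
    exact_mod_cast this

/-- **`ker G_{b,m}ᵀ = 0`** (full row rank). [cite: TillichZemor2014, Thm 1 (§6: a full-rank parity-check matrix)] -/
theorem pcCode_rmGen_transpose (m b : ℕ) : pcCode (rmGen m b)ᵀ = ⊥ :=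
  pcCode_transpose_eq_bot_of_rank_eq _ (by rw [rank_rmGen, Fintype.card_fin])

/-! ## The family theorem -/

/-- ★ **`HGP(G_{b,m}, G_{b,m}) = [[4^m + A², (2^m − A)², 2^{b+1}]]` for every `b < m`**, `A = Σ_{i≤b} C(m,i)` (Tillich–Zémor
Thm 1 with the full-rank seed `G_{b,m}`: `N = n² + A²`, `K = (n − A)²`, `D = d(ker G) = 2^{b+1}`).
[cite: TillichZemor2014, Thm 1 (§6) and Thm 7 / Thm 9 / Lemma 10 (arXiv v1 chunks p0007 L126-135, p0008 L11-15, L57-62)] [cite: MacWilliamsSloane1977, Ch. 13 §3 Thms. 3-4 (chunks p0308-p0309)] -/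
theorem reedMuller_isCode {m b : ℕ} (hb : b < m) :
    (HGP.code (rmGen m b) (rmGen m b)).IsCode (2 ^ m * 2 ^ m + rmRows m b * rmRows m b)
      ((2 ^ m - rmRows m b) * (2 ^ m - rmRows m b)) (2 ^ (b + 1)) :=
  HGP.isCode_of_le_transpose (rmGen m b) (rmGen m b) (rank_rmGen m b) (rank_rmGen m b)
    (minDist_pcCode_rmGen hb) (minDist_pcCode_rmGen hb)
    (by rw [pcCode_rmGen_transpose, minDist_bot]; exact le_top) (by rw [pcCode_rmGen_transpose, minDist_bot]; exact le_top)
    rfl (by rw [Nat.sub_self, zero_mul, add_zero]) (min_self _)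

/-! ## Members -/

/-- `A(2,1) = 3`. [cite: MacWilliamsSloane1977, Ch. 13 §3 (chunk p0306)] -/
theorem rmRows_2_1 : rmRows 2 1 = 3 := by decide
/-- `A(3,1) = 4`. [cite: MacWilliamsSloane1977, Ch. 13 §3 (chunk p0306)] -/
theorem rmRows_3_1 : rmRows 3 1 = 4 := by decide
/-- `A(3,2) = 7`. [cite: MacWilliamsSloane1977, Ch. 13 §3 (chunk p0306)] -/
theorem rmRows_3_2 : rmRows 3 2 = 7 := by decide
/-- `A(4,1) = 5`. [cite: MacWilliamsSloane1977, Ch. 13 §3 (chunk p0306)] -/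
theorem rmRows_4_1 : rmRows 4 1 = 5 := by decide
/-- `A(4,2) = 11`. [cite: MacWilliamsSloane1977, Ch. 13 §3 (chunk p0306)] -/
theorem rmRows_4_2 : rmRows 4 2 = 11 := by decide
/-- `A(5,2) = 16`. [cite: MacWilliamsSloane1977, Ch. 13 §3 (chunk p0306)] -/
theorem rmRows_5_2 : rmRows 5 2 = 16 := by decide
/-- `A(7,3) = 64`. [cite: MacWilliamsSloane1977, Ch. 13 §3 (chunk p0306)] -/
theorem rmRows_7_3 : rmRows 7 3 = 64 := by decide

/-- `(m,b) = (2,1)`: `[[25, 1, 4]]` (`G_{1,2}` = the `3 × 4` check matrix of the `[4,1,4]` repetition code: the distance-4 planar patch).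
[cite: TillichZemor2014, Thm 1 (§6)] -/
theorem hgpRM_2_1 : (HGP.code (rmGen 2 1) (rmGen 2 1)).IsCode 25 1 4 :=
  isCode_congr (reedMuller_isCode (m := 2) (b := 1) (by norm_num)) (by rw [rmRows_2_1]; norm_num) (by rw [rmRows_2_1]; norm_num) rfl

/-- `(m,b) = (3,1)`: `[[80, 16, 4]]` (seed `ker G = ℛ(1,3) = [8,4,4]`, self-dual; rate `1/5`). [cite: TillichZemor2014, Thm 1 (§6)] -/
theorem hgpRM_3_1 : (HGP.code (rmGen 3 1) (rmGen 3 1)).IsCode 80 16 4 :=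
  isCode_congr (reedMuller_isCode (m := 3) (b := 1) (by norm_num)) (by rw [rmRows_3_1]; norm_num) (by rw [rmRows_3_1]; norm_num) rfl

/-- `(m,b) = (3,2)`: `[[113, 1, 8]]` (seed `[8,1,8]`). [cite: TillichZemor2014, Thm 1 (§6)] -/
theorem hgpRM_3_2 : (HGP.code (rmGen 3 2) (rmGen 3 2)).IsCode 113 1 8 :=
  isCode_congr (reedMuller_isCode (m := 3) (b := 2) (by norm_num)) (by rw [rmRows_3_2]; norm_num) (by rw [rmRows_3_2]; norm_num) rfl

/-- `(m,b) = (4,1)`: `[[281, 121, 4]]` (seed `ℛ(2,4) = [16,11,4]`). [cite: TillichZemor2014, Thm 1 (§6)] -/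
theorem hgpRM_4_1 : (HGP.code (rmGen 4 1) (rmGen 4 1)).IsCode 281 121 4 :=
  isCode_congr (reedMuller_isCode (m := 4) (b := 1) (by norm_num)) (by rw [rmRows_4_1]; norm_num) (by rw [rmRows_4_1]; norm_num) rfl

/-- `(m,b) = (4,2)`: `[[377, 25, 8]]` (seed `ℛ(1,4) = [16,5,8]`). [cite: TillichZemor2014, Thm 1 (§6)] -/
theorem hgpRM_4_2 : (HGP.code (rmGen 4 2) (rmGen 4 2)).IsCode 377 25 8 :=
  isCode_congr (reedMuller_isCode (m := 4) (b := 2) (by norm_num)) (by rw [rmRows_4_2]; norm_num) (by rw [rmRows_4_2]; norm_num) rfl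

/-- `(m,b) = (5,2)`: `[[1280, 256, 8]]` (seed `ℛ(2,5) = [32,16,8]`, self-dual; rate `1/5`). [cite: TillichZemor2014, Thm 1 (§6)] -/
theorem hgpRM_5_2 : (HGP.code (rmGen 5 2) (rmGen 5 2)).IsCode 1280 256 8 :=
  isCode_congr (reedMuller_isCode (m := 5) (b := 2) (by norm_num)) (by rw [rmRows_5_2]; norm_num) (by rw [rmRows_5_2]; norm_num) rfl

/-- `(m,b) = (7,3)`: `[[20480, 4096, 16]]` (seed `ℛ(3,7) = [128,64,16]`, self-dual; rate `1/5`). [cite: TillichZemor2014, Thm 1 (§6)] -/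
theorem hgpRM_7_3 : (HGP.code (rmGen 7 3) (rmGen 7 3)).IsCode 20480 4096 16 :=
  isCode_congr (reedMuller_isCode (m := 7) (b := 3) (by norm_num)) (by rw [rmRows_7_3]; norm_num) (by rw [rmRows_7_3]; norm_num) rfl

/-! ## Q4: correction radius -/

/-- `⌊(2^{b+1} − 1)/2⌋ = 2^b − 1`. [folklore] -/
private theorem two_pow_succ_sub_one_div_two (b : ℕ) : (2 ^ (b + 1) - 1) / 2 = 2 ^ b - 1 := by
  have := Nat.one_le_two_pow (n := b)
  rw [pow_succ]; omega

/-- ★ **Q4 — the radius `2^b − 1` is attained and optimal** for every member (`b < m`): some decoder of the flattened code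
corrects every Pauli error of symplectic weight `≤ 2^b − 1` (minimum-weight decoding does), and no decoder corrects all errors
of weight `2^b`. [cite: TillichZemor2014, Thm 1 (§6)] [cite: Gottesman1997, §2.3 (chunk p0014 L3: distance 2t+1 corrects t errors)] -/
theorem reedMuller_hasOptimalRadius {m b : ℕ} (hb : b < m) :
    (HGP.code (rmGen m b) (rmGen m b)).flatFin.HasOptimalRadius (2 ^ b - 1) :=
  (reedMuller_isCode hb).flatFin_hasOptimalRadius (two_pow_succ_sub_one_div_two b)

/-- Q4, sector form: minimum-weight decoding of each sector of `HGP(G_{b,m}, G_{b,m})` corrects every pattern of weight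
`≤ 2^b − 1`. [cite: Gottesman1997, §2.3 (chunk p0014 L3)] -/
theorem reedMuller_minWeight_correctsUpTo {m b : ℕ} (hb : b < m) :
    (Decoder.minWeight (HGP.code (rmGen m b) (rmGen m b)).zSyndrome hammingNorm).CorrectsUpTo
        (HGP.code (rmGen m b) (rmGen m b)).zSyndrome
        ((HGP.code (rmGen m b) (rmGen m b)).rowSpZ : Set (_ → ZMod 2)) hammingNorm (2 ^ b - 1) ∧
      (Decoder.minWeight (HGP.code (rmGen m b) (rmGen m b)).xSyndrome hammingNorm).CorrectsUpTo
        (HGP.code (rmGen m b) (rmGen m b)).xSyndrome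
        ((HGP.code (rmGen m b) (rmGen m b)).rowSpX : Set (_ → ZMod 2)) hammingNorm (2 ^ b - 1) := by
  have h := reedMuller_isCode hb
  rw [← two_pow_succ_sub_one_div_two b]
  exact ⟨h.minWeight_correctsUpToZ, h.minWeight_correctsUpToX⟩

/-! ## Appendix: two different Reed–Muller seeds (Tillich–Zémor Thm 1 / Thm 7 with `H₁ ≠ H₂`) -/

/-- ★ **`HGP(G_{b₁,m₁}, G_{b₂,m₂}) = [[2^{m₁}2^{m₂} + A₁A₂, (2^{m₁} − A₁)(2^{m₂} − A₂), min(2^{b₁+1}, 2^{b₂+1})]]`** for all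
`b₁ < m₁`, `b₂ < m₂` (`Aᵢ = Σ_{j≤bᵢ} C(mᵢ,j)`): the hypergraph product of two (possibly different) Reed–Muller generator matrices.
[cite: TillichZemor2014, Thm 7 / Thm 9 / Lemma 10 (arXiv v1 chunks p0007 L126-135, p0008 L11-15, L57-62)] [cite: MacWilliamsSloane1977, Ch. 13 §3 Thms. 3-4 (chunks p0308-p0309)] -/
theorem reedMuller_isCode₂ {m₁ b₁ m₂ b₂ : ℕ} (hb₁ : b₁ < m₁) (hb₂ : b₂ < m₂) :
    (HGP.code (rmGen m₁ b₁) (rmGen m₂ b₂)).IsCode (2 ^ m₁ * 2 ^ m₂ + rmRows m₁ b₁ * rmRows m₂ b₂)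
      ((2 ^ m₁ - rmRows m₁ b₁) * (2 ^ m₂ - rmRows m₂ b₂)) (min (2 ^ (b₁ + 1)) (2 ^ (b₂ + 1))) :=
  HGP.isCode_of_le_transpose (rmGen m₁ b₁) (rmGen m₂ b₂) (rank_rmGen m₁ b₁) (rank_rmGen m₂ b₂)
    (minDist_pcCode_rmGen hb₁) (minDist_pcCode_rmGen hb₂)
    (by rw [pcCode_rmGen_transpose, minDist_bot]; exact le_top) (by rw [pcCode_rmGen_transpose, minDist_bot]; exact le_top)
    rfl (by rw [Nat.sub_self, zero_mul, add_zero]) rfl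

/-- `HGP(G_{1,3}, G_{2,5}) = [[320, 64, 4]]` (seeds `ℛ(1,3) = [8,4,4]` and `ℛ(2,5) = [32,16,8]`).
[cite: TillichZemor2014, Thm 7 (§4)] -/
theorem hgpRM_3_1_5_2 : (HGP.code (rmGen 3 1) (rmGen 5 2)).IsCode 320 64 4 :=
  isCode_congr (reedMuller_isCode₂ (m₁ := 3) (b₁ := 1) (m₂ := 5) (b₂ := 2) (by norm_num) (by norm_num))
    (by rw [rmRows_3_1, rmRows_5_2]; norm_num) (by rw [rmRows_3_1, rmRows_5_2]; norm_num) (by norm_num)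

/-- `HGP(G_{2,5}, G_{3,7}) = [[5120, 1024, 8]]` (seeds `[32,16,8]` and `[128,64,16]`). [cite: TillichZemor2014, Thm 7 (§4)] -/
theorem hgpRM_5_2_7_3 : (HGP.code (rmGen 5 2) (rmGen 7 3)).IsCode 5120 1024 8 :=
  isCode_congr (reedMuller_isCode₂ (m₁ := 5) (b₁ := 2) (m₂ := 7) (b₂ := 3) (by norm_num) (by norm_num))
    (by rw [rmRows_5_2, rmRows_7_3]; norm_num) (by rw [rmRows_5_2, rmRows_7_3]; norm_num) (by norm_num)

end Summit.Ventures.QEC.HGP
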